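import Summits.KontsevichZagierPeriods.KontsevichZagierPeriods.Theorems.LinRedNormalFormArrangementNormalFormSeparateHighResultant

/-!
# The fan lemma of `stub_separateHigh`, combinatorial core: slopes of bad candidates

(Line `janus-bands`, crux `ArrangementNormalForm`, stub `stub_separateHigh` — separation in base
dimension `≥ 3`; part `FanSlopes`, affine geometry in the base `ℝⁿ`, valid in every dimension.)

Fix a piece `T` of the base cell, two letters `c, c'` (rational affine forms with linearly
independent linear parts) of constant strict signs on `T`, and the `N` moment-curve candidate
directions `v_l = cand n l`. Suppose that for every candidate with `∂L = dv c v_l ≠ 0`,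
`∂L' = dv c' v_l ≠ 0` the resultant `res c c' v_l = ∂L · L' − ∂L' · L` has a constant strict
sign on `T` (this is what cutting the cell along all resultant hyperplanes `resForm` buys).
Call such a candidate BAD if the ratio condition `|L'| ≤ C |res|` fails on `T` for every `C`.
* `SepHigh.three_slopes`: of three lines through the origin of the quadrant `{a, b > 0}` with
  slopes `τ₁ < τ₂ < τ₃`, the middle one not crossing a set, one of the outer two is
  quantitatively transversal to the set (`κ b ≤ |b − τ a|`);
* hence the bad candidates have at most TWO distinct slopes `∂L' / ∂L` (`SepHigh.bad_slopes_two`),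
  so by the quantitative independence of the candidates (`SepHigh.exists_eta`: at most `n − 1`
  candidates are orthogonal to a given non-zero vector) there are at most `2 (n − 1)` of them
  (`SepHigh.exists_bad_finset`);
* pigeonhole over the active pairs (`SepHigh.exists_fan_cand`, registered in literal form as
  `separateHigh_fanSlopes`): with `N > 2 (n − 1) · #P` candidates some candidate satisfies the
  ratio condition on `T` for every pair of `P` for which both letters are active.
No smallness of the piece is needed: the dissection along the resultant hyperplanes through the
codimension-2 flats is the conical refinement at the flats touching the closed cell.
-/

noncomputable section

open Finset

namespace Summit.KontsevichZagierPeriods.ArrangementNormalForm.JanusBands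

namespace SepHigh

variable {n : ℕ}

/-! ### The resultant as a rational affine form -/

/-- The resultant `∂ᵥL · L' − ∂ᵥL' · L` of two letters along `v`, as a rational affine form. -/
def resForm (c c' : (Fin n → ℚ) × ℚ) (v : Fin n → ℚ) : (Fin n → ℚ) × ℚ :=
  dv c v • c' - dv c' v • c

/-- The value of the resultant form is the resultant. [folklore] -/
theorem ev_resForm (c c' : (Fin n → ℚ) × ℚ) (v : Fin n → ℚ) (x : Fin n → ℝ) :
    ev (resForm c c' v) x = res c c' v x := by
  simp only [resForm, ev, res, Prod.fst_sub, Prod.snd_sub, Prod.smul_fst, Prod.smul_snd,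
    Pi.sub_apply, Pi.smul_apply, smul_eq_mul, Rat.cast_sub, Rat.cast_mul, sub_mul,
    Finset.sum_sub_distrib, mul_add, Finset.mul_sum]
  ring

/-- The resultant form of two letters with independent linear parts along a direction moving at
least one of them is non-zero. [folklore] -/
theorem resForm_ne_zero (c c' : (Fin n → ℚ) × ℚ) (v : Fin n → ℚ)
    (hind : ∀ μ ν : ℚ, μ • c.1 + ν • c'.1 = 0 → μ = 0 ∧ ν = 0)
    (h : dv c v ≠ 0 ∨ dv c' v ≠ 0) : resForm c c' v ≠ 0 := by
  intro h0
  have h1 : (-dv c' v) • c.1 + dv c v • c'.1 = 0 := by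
    have h2 := congr_arg Prod.fst h0
    simp only [resForm, Prod.fst_sub, Prod.smul_fst, Prod.fst_zero] at h2
    rw [neg_smul, add_comm, ← sub_eq_add_neg]
    exact h2
  obtain ⟨h2, h3⟩ := hind _ _ h1
  rcases h with h | h
  · exact h h3
  · exact h (neg_eq_zero.1 h2)

/-! ### Three slopes -/

/-- **Three slopes.** On a set where `a, b > 0`, if the line of slope `τ₂` does not cross
(`b − τ₂ a` has a constant strict sign) and `τ₁ < τ₂ < τ₃`, then one of the outer lines is
quantitatively transversal: `κ b ≤ |b − τ₁ a|` or `κ b ≤ |b − τ₃ a|` for some `κ > 0`.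
[folklore] -/
theorem three_slopes {X : Type*} (T : Set X) (a b : X → ℝ) (ha : ∀ y ∈ T, 0 < a y)
    (hb : ∀ y ∈ T, 0 < b y) {τ₁ τ₂ τ₃ : ℝ} (h12 : τ₁ < τ₂) (h23 : τ₂ < τ₃)
    (hs : (∀ y ∈ T, 0 < b y - τ₂ * a y) ∨ (∀ y ∈ T, b y - τ₂ * a y < 0)) :
    (∃ κ : ℝ, 0 < κ ∧ ∀ y ∈ T, κ * b y ≤ |b y - τ₁ * a y|) ∨
      (∃ κ : ℝ, 0 < κ ∧ ∀ y ∈ T, κ * b y ≤ |b y - τ₃ * a y|) := by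
  rcases hs with hpos | hneg
  · left
    by_cases h1 : τ₁ ≤ 0
    · refine ⟨1, one_pos, fun y hy => ?_⟩
      have e1 := hpos y hy
      have e2 := ha y hy
      have e3 := hb y hy
      have e4 : 0 ≤ -τ₁ * a y := mul_nonneg (by linarith) e2.le
      rw [abs_of_pos (by nlinarith)]
      nlinarith
    · push Not at h1
      have h2 : 0 < τ₂ := h1.trans h12
      have hκ : 0 < 1 - τ₁ / τ₂ := by
        rw [sub_pos, div_lt_one h2]
        exact h12
      refine ⟨1 - τ₁ / τ₂, hκ, fun y hy => ?_⟩
      have e1 := hpos y hy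
      have e3 := hb y hy
      have h3 : τ₁ * a y < τ₁ / τ₂ * b y := by
        rw [div_mul_eq_mul_div, lt_div_iff₀ h2]
        nlinarith
      have h4 : (1 - τ₁ / τ₂) * b y < b y - τ₁ * a y := by nlinarith
      have h5 : 0 < (1 - τ₁ / τ₂) * b y := mul_pos hκ e3
      rw [abs_of_pos (h5.trans h4)]
      exact h4.le
  · right
    rcases T.eq_empty_or_nonempty with rfl | ⟨y₀, hy₀⟩
    · exact ⟨1, one_pos, fun y hy => absurd hy (Set.notMem_empty y)⟩
    · have h2 : 0 < τ₂ := by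
        have e1 := hneg y₀ hy₀
        have e2 := ha y₀ hy₀
        have e3 := hb y₀ hy₀
        by_contra h
        push Not at h
        nlinarith
      refine ⟨(τ₃ - τ₂) / τ₂, div_pos (sub_pos.2 h23) h2, fun y hy => ?_⟩
      have e1 := hneg y hy
      have e2 := ha y hy
      have e3 := hb y hy
      have h5 : b y / τ₂ < a y := by
        rw [div_lt_iff₀ h2]
        linarith
      have h6 : (τ₃ - τ₂) / τ₂ * b y < τ₃ * a y - b y := by
        have h7 : (τ₃ - τ₂) / τ₂ * b y = (τ₃ - τ₂) * (b y / τ₂) := by ring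
        rw [h7]
        nlinarith [mul_lt_mul_of_pos_left h5 (sub_pos.2 h23)]
      rw [abs_of_neg (by nlinarith), neg_sub]
      exact h6.le

/-! ### Bad candidates of a pair have at most two slopes -/

/-- A constant strict sign as a unit rational factor. [folklore] -/
theorem exists_sign {X : Type*} (T : Set X) (f : X → ℝ)
    (h : (∀ y ∈ T, 0 < f y) ∨ (∀ y ∈ T, f y < 0)) :
    ∃ ε : ℚ, (ε = 1 ∨ ε = -1) ∧ ∀ y ∈ T, 0 < (ε : ℝ) * f y := by
  rcases h with h | h
  · exact ⟨1, Or.inl rfl, fun y hy => by simpa using h y hy⟩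
  · exact ⟨-1, Or.inr rfl, fun y hy => by simpa using h y hy⟩

/-- The resultant in the sign-corrected letters `a = ε L`, `b = ε' L'`:
`res = (∂L · ε') (b − τ a)` with `τ = (∂L' / ∂L) ε ε'`. [folklore] -/
theorem res_eq_signed (c c' : (Fin n → ℚ) × ℚ) (v : Fin n → ℚ) {ε ε' : ℚ}
    (hε : ε = 1 ∨ ε = -1) (hε' : ε' = 1 ∨ ε' = -1) (hα : dv c v ≠ 0) (x : Fin n → ℝ) :
    res c c' v x = ((dv c v * ε' : ℚ) : ℝ) *
      ((ε' : ℝ) * ev c' x - ((dv c' v / dv c v * (ε * ε') : ℚ) : ℝ) * ((ε : ℝ) * ev c x)) := by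
  have h1 : (ε : ℝ) * ε = 1 := by
    rcases hε with rfl | rfl <;> norm_num
  have h2 : (ε' : ℝ) * ε' = 1 := by
    rcases hε' with rfl | rfl <;> norm_num
  have hα' : ((dv c v : ℚ) : ℝ) ≠ 0 := by exact_mod_cast hα
  simp only [res, Rat.cast_mul, Rat.cast_div]
  field_simp
  linear_combination ((dv c' v : ℚ) : ℝ) * ev c x * (ε' : ℝ) * (ε' : ℝ) * h1 +
    (((dv c' v : ℚ) : ℝ) * ev c x - ((dv c v : ℚ) : ℝ) * ev c' x) * h2

/-- **The bad candidates of a pair have at most two slopes.** Letters `c, c'` of constant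
strict signs on `T`; every candidate moving both letters has a resultant of constant strict
sign on `T`; then the candidates moving both letters for which the ratio condition
`|L'| ≤ C |res|` fails on `T` have at most two distinct slopes `∂L' / ∂L`. [folklore] -/
theorem bad_slopes_two {X : Type*} (T : Set X) (x : X → Fin n → ℝ) (c c' : (Fin n → ℚ) × ℚ)
    (N : ℕ) (hc : (∀ y ∈ T, 0 < ev c (x y)) ∨ (∀ y ∈ T, ev c (x y) < 0))
    (hc' : (∀ y ∈ T, 0 < ev c' (x y)) ∨ (∀ y ∈ T, ev c' (x y) < 0))
    (hres : ∀ l < N, dv c (cand n l) ≠ 0 → dv c' (cand n l) ≠ 0 →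
      (∀ y ∈ T, 0 < res c c' (cand n l) (x y)) ∨ (∀ y ∈ T, res c c' (cand n l) (x y) < 0)) :
    ∃ t₁ t₂ : ℚ, ∀ l < N, dv c (cand n l) ≠ 0 → dv c' (cand n l) ≠ 0 →
      (¬ ∃ C : ℝ, ∀ y ∈ T, |ev c' (x y)| ≤ C * |res c c' (cand n l) (x y)|) →
      dv c' (cand n l) / dv c (cand n l) = t₁ ∨ dv c' (cand n l) / dv c (cand n l) = t₂ := by
  obtain ⟨ε, hε, hεc⟩ := exists_sign T (fun y => ev c (x y)) hc
  obtain ⟨ε', hε', hεc'⟩ := exists_sign T (fun y => ev c' (x y)) hc'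
  have hεε : ε * ε' * (ε * ε') = 1 := by
    rcases hε with rfl | rfl <;> rcases hε' with rfl | rfl <;> norm_num
  -- sign-corrected letters and slopes
  set a : X → ℝ := fun y => (ε : ℝ) * ev c (x y) with ha
  set b : X → ℝ := fun y => (ε' : ℝ) * ev c' (x y) with hb
  set τ : ℕ → ℚ := fun l => dv c' (cand n l) / dv c (cand n l) * (ε * ε') with hτ
  have hab : ∀ l, dv c (cand n l) ≠ 0 → ∀ y, res c c' (cand n l) (x y) =
      ((dv c (cand n l) * ε' : ℚ) : ℝ) * (b y - (τ l : ℝ) * a y) := fun l hα y =>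
    res_eq_signed c c' (cand n l) hε hε' hα (x y)
  have habs : ∀ y, |ev c' (x y)| = |b y| := fun y => by
    rw [hb]
    dsimp only
    rw [abs_mul]
    rcases hε' with rfl | rfl <;> simp
  -- the bad candidates
  set Bad : ℕ → Prop := fun l => l < N ∧ dv c (cand n l) ≠ 0 ∧ dv c' (cand n l) ≠ 0 ∧
    ¬ ∃ C : ℝ, ∀ y ∈ T, |ev c' (x y)| ≤ C * |res c c' (cand n l) (x y)| with hBad
  -- (i) constant sign of `b − τ a` for candidates moving both letters
  have hsgn : ∀ l, Bad l → (∀ y ∈ T, 0 < b y - (τ l : ℝ) * a y) ∨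
      (∀ y ∈ T, b y - (τ l : ℝ) * a y < 0) := by
    rintro l ⟨hl, hα, hβ, -⟩
    have hu : ((dv c (cand n l) * ε' : ℚ) : ℝ) ≠ 0 := by
      have : dv c (cand n l) * ε' ≠ 0 := mul_ne_zero hα (by rcases hε' with rfl | rfl <;> norm_num)
      exact_mod_cast this
    rcases hres l hl hα hβ with h | h
    · rcases lt_or_gt_of_ne hu with hu | hu
      · refine Or.inr fun y hy => ?_
        have h1 := h y hy
        rw [hab l hα y] at h1
        exact neg_of_mul_pos_right h1 hu.le
      · refine Or.inl fun y hy => ?_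
        have h1 := h y hy
        rw [hab l hα y] at h1
        exact pos_of_mul_pos_right h1 hu.le
    · rcases lt_or_gt_of_ne hu with hu | hu
      · refine Or.inl fun y hy => ?_
        have h1 := h y hy
        rw [hab l hα y] at h1
        exact pos_of_mul_neg_right h1 hu.le
      · refine Or.inr fun y hy => ?_
        have h1 := h y hy
        rw [hab l hα y] at h1
        exact neg_of_mul_neg_right h1 hu.le
  -- (ii) a transversality bound makes a candidate good
  have hgood : ∀ l, Bad l → ¬ ∃ κ : ℝ, 0 < κ ∧ ∀ y ∈ T, κ * b y ≤ |b y - (τ l : ℝ) * a y| := by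
    rintro l ⟨-, hα, -, hC⟩ ⟨κ, hκ, hκb⟩
    apply hC
    have hu : 0 < |((dv c (cand n l) * ε' : ℚ) : ℝ)| := by
      have : dv c (cand n l) * ε' ≠ 0 := mul_ne_zero hα (by rcases hε' with rfl | rfl <;> norm_num)
      exact abs_pos.2 (by exact_mod_cast this)
    refine ⟨1 / (κ * |((dv c (cand n l) * ε' : ℚ) : ℝ)|), fun y hy => ?_⟩
    rw [hab l hα y, abs_mul, habs y, abs_of_pos (hεc' y hy)]
    rw [one_div, inv_mul_eq_div, le_div_iff₀ (mul_pos hκ hu)]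
    calc b y * (κ * |((dv c (cand n l) * ε' : ℚ) : ℝ)|) =
        |((dv c (cand n l) * ε' : ℚ) : ℝ)| * (κ * b y) := by ring
      _ ≤ _ := mul_le_mul_of_nonneg_left (hκb y hy) (abs_nonneg _)
  -- (iii) no three bad candidates with increasing slopes
  have hthree : ∀ l₁ l₂ l₃, Bad l₁ → Bad l₂ → Bad l₃ → τ l₁ < τ l₂ → τ l₂ < τ l₃ → False := by
    intro l₁ l₂ l₃ h₁ h₂ h₃ h12 h23
    have h12' : (τ l₁ : ℝ) < τ l₂ := by exact_mod_cast h12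
    have h23' : (τ l₂ : ℝ) < τ l₃ := by exact_mod_cast h23
    rcases three_slopes T a b hεc hεc' h12' h23' (hsgn l₂ h₂) with h | h
    · exact hgood l₁ h₁ h
    · exact hgood l₃ h₃ h
  -- hence at most two slopes `τ`, i.e. at most two slopes `∂L' / ∂L`
  have key : ∃ t₁ t₂ : ℚ, ∀ l, Bad l → τ l = t₁ ∨ τ l = t₂ := by
    by_cases h1 : ∃ l₁, Bad l₁
    · obtain ⟨l₁, hl₁⟩ := h1
      by_cases h2 : ∃ l₂, Bad l₂ ∧ τ l₂ ≠ τ l₁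
      · obtain ⟨l₂, hl₂, hne⟩ := h2
        refine ⟨τ l₁, τ l₂, fun l hl => ?_⟩
        by_contra h
        push Not at h
        obtain ⟨h3, h4⟩ := h
        rcases lt_trichotomy (τ l₁) (τ l₂) with h5 | h5 | h5
        · rcases lt_trichotomy (τ l) (τ l₁) with h6 | h6 | h6
          · exact hthree l l₁ l₂ hl hl₁ hl₂ h6 h5
          · exact h3 h6
          · rcases lt_trichotomy (τ l) (τ l₂) with h7 | h7 | h7
            · exact hthree l₁ l l₂ hl₁ hl hl₂ h6 h7
            · exact h4 h7
            · exact hthree l₁ l₂ l hl₁ hl₂ hl h5 h7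
        · exact hne h5.symm
        · rcases lt_trichotomy (τ l) (τ l₂) with h6 | h6 | h6
          · exact hthree l l₂ l₁ hl hl₂ hl₁ h6 h5
          · exact h4 h6
          · rcases lt_trichotomy (τ l) (τ l₁) with h7 | h7 | h7
            · exact hthree l₂ l l₁ hl₂ hl hl₁ h6 h7
            · exact h3 h7
            · exact hthree l₂ l₁ l hl₂ hl₁ hl h5 h7
      · push Not at h2
        exact ⟨τ l₁, τ l₁, fun l hl => Or.inl (h2 l hl)⟩
    · push Not at h1
      exact ⟨0, 0, fun l hl => absurd hl (h1 l)⟩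
  obtain ⟨t₁, t₂, ht⟩ := key
  refine ⟨t₁ * (ε * ε'), t₂ * (ε * ε'), fun l hl hα hβ hC => ?_⟩
  rcases ht l ⟨hl, hα, hβ, hC⟩ with h | h
  · left
    calc dv c' (cand n l) / dv c (cand n l) = τ l * (ε * ε') := by
          rw [hτ]
          dsimp only
          rw [mul_assoc, hεε, mul_one]
      _ = t₁ * (ε * ε') := by rw [h]
  · right
    calc dv c' (cand n l) / dv c (cand n l) = τ l * (ε * ε') := by
          rw [hτ]
          dsimp only
          rw [mul_assoc, hεε, mul_one]
      _ = t₂ * (ε * ε') := by rw [h]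

/-! ### Counting the bad candidates -/

/-- The vector `w(t) = t ℓ − ℓ'` testing the slope `t`: `⟨w(t), v⟩ = t ∂L − ∂L'`. -/
def slopeVec (c c' : (Fin n → ℚ) × ℚ) (t : ℚ) : Fin n → ℝ :=
  fun i => (((t * c.1 i - c'.1 i : ℚ)) : ℝ)

/-- `⟨w(t), v⟩ = t ∂ᵥL − ∂ᵥL'`. [folklore] -/
theorem pair_slopeVec (c c' : (Fin n → ℚ) × ℚ) (t : ℚ) (v : Fin n → ℚ) :
    pair (slopeVec c c' t) v = ((t * dv c v - dv c' v : ℚ) : ℝ) := by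
  simp only [pair, slopeVec, dv, Rat.cast_sub, Rat.cast_mul, Rat.cast_sum, Finset.mul_sum,
    ← Finset.sum_sub_distrib]
  exact Finset.sum_congr rfl fun i _ => by ring

/-- `w(t) ≠ 0` for letters with independent linear parts. [folklore] -/
theorem slopeVec_ne_zero (c c' : (Fin n → ℚ) × ℚ) (t : ℚ)
    (hind : ∀ μ ν : ℚ, μ • c.1 + ν • c'.1 = 0 → μ = 0 ∧ ν = 0) : slopeVec c c' t ≠ 0 := by
  intro h0
  have h1 : t • c.1 + (-1 : ℚ) • c'.1 = 0 := by
    funext i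
    have h2 : (((t * c.1 i - c'.1 i : ℚ)) : ℝ) = 0 := congr_fun h0 i
    have h3 : t * c.1 i - c'.1 i = 0 := by exact_mod_cast h2
    simp only [Pi.add_apply, Pi.smul_apply, smul_eq_mul, Pi.zero_apply]
    linear_combination h3
  have := (hind _ _ h1).2
  norm_num at this

/-- **At most `2 (n − 1)` bad candidates per pair**: under the hypotheses of `bad_slopes_two`
and the quantitative independence `η` of the candidates (`exists_eta`), all but at most
`2 (n − 1)` candidates `l < N` moving both letters satisfy the ratio condition on `T`.
[folklore] -/
theorem exists_bad_finset {X : Type*} (T : Set X) (x : X → Fin n → ℝ) (c c' : (Fin n → ℚ) × ℚ)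
    (N : ℕ) {η : ℝ} (hη0 : 0 < η)
    (hη : ∀ w : Fin n → ℝ, w ≠ 0 →
      ((Finset.range N).filter fun l => |pair w (cand n l)| < η * ‖w‖).card ≤ n - 1)
    (hind : ∀ μ ν : ℚ, μ • c.1 + ν • c'.1 = 0 → μ = 0 ∧ ν = 0)
    (hc : (∀ y ∈ T, 0 < ev c (x y)) ∨ (∀ y ∈ T, ev c (x y) < 0))
    (hc' : (∀ y ∈ T, 0 < ev c' (x y)) ∨ (∀ y ∈ T, ev c' (x y) < 0))
    (hres : ∀ l < N, dv c (cand n l) ≠ 0 → dv c' (cand n l) ≠ 0 →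
      (∀ y ∈ T, 0 < res c c' (cand n l) (x y)) ∨ (∀ y ∈ T, res c c' (cand n l) (x y) < 0)) :
    ∃ Bad : Finset ℕ, Bad.card ≤ 2 * (n - 1) ∧ ∀ l < N, l ∉ Bad → dv c (cand n l) ≠ 0 →
      dv c' (cand n l) ≠ 0 → ∃ C : ℝ, ∀ y ∈ T, |ev c' (x y)| ≤ C * |res c c' (cand n l) (x y)| := by
  obtain ⟨t₁, t₂, ht⟩ := bad_slopes_two T x c c' N hc hc' hres
  set F : ℚ → Finset ℕ := fun t => (Finset.range N).filter fun l =>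
    |pair (slopeVec c c' t) (cand n l)| < η * ‖slopeVec c c' t‖ with hF
  have hFcard : ∀ t, (F t).card ≤ n - 1 := fun t => hη _ (slopeVec_ne_zero c c' t hind)
  have hFmem : ∀ t, ∀ l < N, dv c (cand n l) ≠ 0 → dv c' (cand n l) / dv c (cand n l) = t →
      l ∈ F t := by
    intro t l hl hα h
    refine Finset.mem_filter.2 ⟨Finset.mem_range.2 hl, ?_⟩
    have h1 : t * dv c (cand n l) - dv c' (cand n l) = 0 := by
      rw [← h, div_mul_cancel₀ _ hα, sub_self]
    rw [pair_slopeVec, h1, Rat.cast_zero, abs_zero]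
    exact mul_pos hη0 (norm_pos_iff.2 (slopeVec_ne_zero c c' t hind))
  refine ⟨F t₁ ∪ F t₂, (Finset.card_union_le _ _).trans ?_, fun l hl hlB hα hβ => ?_⟩
  · have := hFcard t₁
    have := hFcard t₂
    omega
  · by_contra hC
    rcases ht l hl hα hβ hC with h | h
    · exact hlB (Finset.mem_union_left _ (hFmem t₁ l hl hα h))
    · exact hlB (Finset.mem_union_right _ (hFmem t₂ l hl hα h))

/-- **Pigeonhole over the pairs**: with `N > 2 (n − 1) · #P` candidates, some candidate `l < N`
satisfies the ratio condition on `T` for every pair of `P` both of whose letters it moves.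
[folklore] -/
theorem exists_fan_cand {X : Type*} (T : Set X) (x : X → Fin n → ℝ) {m : ℕ}
    (L : Fin m → (Fin n → ℚ) × ℚ) (P : Finset (Fin m × Fin m)) (N : ℕ) {η : ℝ} (hη0 : 0 < η)
    (hη : ∀ w : Fin n → ℝ, w ≠ 0 →
      ((Finset.range N).filter fun l => |pair w (cand n l)| < η * ‖w‖).card ≤ n - 1)
    (hind : ∀ q ∈ P, ∀ μ ν : ℚ, μ • (L q.1).1 + ν • (L q.2).1 = 0 → μ = 0 ∧ ν = 0)
    (hsgn : ∀ q ∈ P, ((∀ y ∈ T, 0 < ev (L q.1) (x y)) ∨ (∀ y ∈ T, ev (L q.1) (x y) < 0)) ∧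
      ((∀ y ∈ T, 0 < ev (L q.2) (x y)) ∨ (∀ y ∈ T, ev (L q.2) (x y) < 0)))
    (hres : ∀ q ∈ P, ∀ l < N, dv (L q.1) (cand n l) ≠ 0 → dv (L q.2) (cand n l) ≠ 0 →
      (∀ y ∈ T, 0 < res (L q.1) (L q.2) (cand n l) (x y)) ∨
        (∀ y ∈ T, res (L q.1) (L q.2) (cand n l) (x y) < 0))
    (hN : 2 * (n - 1) * P.card < N) :
    ∃ l < N, ∀ q ∈ P, dv (L q.1) (cand n l) ≠ 0 → dv (L q.2) (cand n l) ≠ 0 →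
      ∃ C : ℝ, ∀ y ∈ T, |ev (L q.2) (x y)| ≤ C * |res (L q.1) (L q.2) (cand n l) (x y)| := by
  classical
  have hex : ∀ q, ∃ Bad : Finset ℕ, Bad.card ≤ 2 * (n - 1) ∧ (q ∈ P → ∀ l < N, l ∉ Bad →
      dv (L q.1) (cand n l) ≠ 0 → dv (L q.2) (cand n l) ≠ 0 →
      ∃ C : ℝ, ∀ y ∈ T, |ev (L q.2) (x y)| ≤ C * |res (L q.1) (L q.2) (cand n l) (x y)|) := by
    intro q
    by_cases hq : q ∈ P
    · obtain ⟨Bad, hcard, hBad⟩ := exists_bad_finset T x (L q.1) (L q.2) N hη0 hη (hind q hq)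
        (hsgn q hq).1 (hsgn q hq).2 (hres q hq)
      exact ⟨Bad, hcard, fun _ => hBad⟩
    · exact ⟨∅, by simp, fun h => absurd h hq⟩
  choose Bad hcard hBad using hex
  set U : Finset ℕ := P.biUnion Bad with hU
  have hUcard : U.card ≤ 2 * (n - 1) * P.card := by
    refine Finset.card_biUnion_le.trans ?_
    rw [mul_comm]
    exact Finset.sum_le_card_nsmul _ _ _ fun q _ => hcard q
  have hne : (Finset.range N \ U).Nonempty := by
    rw [← Finset.card_pos]
    have h1 := Finset.le_card_sdiff U (Finset.range N)
    rw [Finset.card_range] at h1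
    omega
  obtain ⟨l, hl⟩ := hne
  rw [Finset.mem_sdiff, Finset.mem_range] at hl
  refine ⟨l, hl.1, fun q hq hα hβ => hBad q hq l hl.1 (fun hlq => ?_) hα hβ⟩
  exact hl.2 (Finset.mem_biUnion.2 ⟨q, hq, hlq⟩)

end SepHigh

open SepHigh in
/-- **Pigeonhole choice of a fan direction on a piece** (registered part of `stub_separateHigh`;
literal form of `SepHigh.exists_fan_cand`): on a piece `T` on which the letters of the pairs of
`P` have constant strict signs and every resultant of a candidate moving both letters of a pair
has a constant strict sign, some candidate `l < N` (`N > 2 (n − 1) · #P`) satisfies the ratio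
condition `|L'| ≤ C |∂L · L' − ∂L' · L|` for every pair of `P` both of whose letters it moves.
[folklore] -/
theorem separateHigh_fanSlopes (n : ℕ) (X : Type) (T : Set X) (x : X → Fin n → ℝ) (m : ℕ) (L : Fin m → (Fin n → ℚ) × ℚ) (P : Finset (Fin m × Fin m)) (N : ℕ) (η : ℝ) (hη0 : 0 < η) (hη : ∀ w : Fin n → ℝ, w ≠ 0 → ((Finset.range N).filter fun l => |SepHigh.pair w (SepHigh.cand n l)| < η * ‖w‖).card ≤ n - 1) (hind : ∀ q ∈ P, ∀ μ ν : ℚ, μ • (L q.1).1 + ν • (L q.2).1 = 0 → μ = 0 ∧ ν = 0) (hsgn : ∀ q ∈ P, ((∀ y ∈ T, 0 < SepHigh.ev (L q.1) (x y)) ∨ (∀ y ∈ T, SepHigh.ev (L q.1) (x y) < 0)) ∧ ((∀ y ∈ T, 0 < SepHigh.ev (L q.2) (x y)) ∨ (∀ y ∈ T, SepHigh.ev (L q.2) (x y) < 0))) (hres : ∀ q ∈ P, ∀ l < N, SepHigh.dv (L q.1) (SepHigh.cand n l) ≠ 0 → SepHigh.dv (L q.2) (SepHigh.cand n l) ≠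 0 → (∀ y ∈ T, 0 < SepHigh.res (L q.1) (L q.2) (SepHigh.cand n l) (x y)) ∨ (∀ y ∈ T, SepHigh.res (L q.1) (L q.2) (SepHigh.cand n l) (x y) < 0)) (hN : 2 * (n - 1) * P.card < N) : ∃ l < N, ∀ q ∈ P, SepHigh.dv (L q.1) (SepHigh.cand n l) ≠ 0 → SepHigh.dv (L q.2) (SepHigh.cand n l) ≠ 0 → ∃ C : ℝ, ∀ y ∈ T, |SepHigh.ev (L q.2) (x y)| ≤ C * |SepHigh.res (L q.1) (L q.2) (SepHigh.cand n l) (x y)| :=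
  exists_fan_cand T x L P N hη0 hη hind hsgn hres hN

end Summit.KontsevichZagierPeriods.ArrangementNormalForm.JanusBands
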